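import Summits.RiemannHypothesis.RiemannHypothesis.Theorems.Splittings.ScrewBridgeRungs
import HarnessLib

/-!
# Splittings — screw bridge gen 4, §7: the SHARP orbit bound `n₋(S_n) ≤ 2·#{Klein orbits of off-line zeros}`
# (RH-free, zero-definition raw form) and Lemma U re-typed with the factor 2

Cell rh-split, seat rh-split-screw-bridge g4 (brief sha16 f79c5f09d8bcb036); filed VERBATIM (namespace renamed to the
referee's file name `ScrewOrbitIndexBound`) by rh-split-typer-1 g3 from `HOME/rh-split-screw-bridge/ScrewBridgeG4Q.lean`
sha16 e2b2d8adab7a7315 (referee g2 content+bytes PASS 2026-08-27T01:37Z); scratch of the gen-4 addendum §9 of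
`run/shared/lean/pub/rh-split/cards/SPLIT-screw-bridge.md`, answering rh-splitx-eng-3 g0 (00:38:42Z), the referee
rh-split-ref g2 (00:46:38Z) and the lead (00:47:13Z item (4)): the statement-side finding on the typed Lemma U.
Notation (written out, no definitions): `n₋(n) = #{i | λ_i(screwMatrix n) < 0}`; the «quadrant representative» of
`s` is the point `⟨max (Re s) (1 − Re s), |Im s|⟩`, whose fibre is the Klein orbit `{b, b̄, 1 − b̄, 1 − b}`;
`zeroTerm n v ρ = m(ρ)·(−P_v(ρ−½)·P_v(−(ρ−½)))/(ρ−½)²` is the tree's `ρ`-term of Suzuki's zero expansion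
`vᵀ S_n v = Σ_ρ Re zeroTerm n v ρ` (`IntegerScrew.FozIndexBound.hasSum_re_zeroTerm`, exact, no remainder).

* §7a ORBIT INVARIANCE (kernel): `zeroTerm_one_sub` (`ρ ↦ 1 − ρ`, via `m(1−ρ) = m(ρ)`), `zeroTerm_conj`
  (`ρ ↦ ρ̄` conjugates the term, via `m(ρ̄) = m(ρ)` and real coefficients), hence `re_zeroTerm_rep`: the REAL zero
  term is constant on each Klein orbit — the four members of an off-line quadruple contribute the SAME real form
  `ℓ₁ℓ₃ − ℓ₂ℓ₄` (`re_zeroTerm_eq_ell`), of signature `≤ (2,2)`.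
* §7b THE SHARP BOUND (kernel, RH-free): `negIndex_le_two_mul_card_reps` — if a finite set `R ⊂ ℂ` contains the
  representative of every off-line non-trivial zero, then `n₋(S_n) ≤ 2·#R` for EVERY `n` (so one quadruple of
  simple or multiple zeros can never produce more than two negative eigenvalues; the tree's `fozIndexBound` proves
  the weaker `2·#{off-line zeros}` = `8` per quadruple); FOZ form `foz_negIndex_le_two_mul_card_reps`.
* §7c THE TYPED LEMMA U IS UNATTAINABLE OFF RH (kernel): `rh_of_foz_of_indexLowerBound` — the hypothesis `hU` of the
  landed `ScrewBridgeRungs.indexTransfer_of_indexLowerBound` («every finite set F of OFF-LINE zeros is eventually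
  matched by F.card negative eigenvalues») together with FOZ gives RH (under FOZ ∧ ¬RH: `#O ≥ 3·#R > 2·#R ≥ n₋`,
  `three_le_card_fibre`); with the vacuous converse, `indexLowerBound_and_foz_iff_rh`: «hU ∧ FOZ ⟺ RH» — hU is of
  strength ≥ FOZ → RH, exactly as rh-splitx-eng-3 found; the landed theorem stays true but applies only vacuously.
* §7d LEMMA U WITH THE FACTOR 2 (kernel): `indexTransfer_of_indexLowerBound_two` — the transfer theorem re-proved
  verbatim from `hU′ : ∀ F off-line, eventually F.card ≤ 2·n₋` (the referee's T-R3′ of record); the companion over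
  representatives (`hU_quad : q representatives ⟹ eventually n₋ ≥ q`, WEAKER than hU′, hence a STRONGER transfer
  theorem) is `ScrewBridgeG4.indexTransfer_of_indexLowerBoundQuad` (HOME/rh-split-screw-bridge/ScrewBridgeG4.lean §5).

Everything here is RH-free linear algebra on the tree's own zero expansion; nothing is conditional.
HONEST LABEL: SPLITTING SEARCH over kernel-typed RH-EQUIVALENCES; a splitting A ∧ B ⟹ RH is CONDITIONAL
bookkeeping unless A and B are both proved; nothing here bears on the truth of RH.
-/

set_option linter.dupNamespace false

noncomputable section

namespace Summit.RiemannHypothesis.RiemannHypothesis.Theorems.Splittings.ScrewOrbitIndexBound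

open Finset Matrix
open scoped ComplexConjugate
open Literature.NumberTheory.LFunctions
open Summit.RiemannHypothesis.RiemannHypothesis.Theses.RuelleBand
open Summit.RiemannHypothesis.RiemannHypothesis.Theorems.IntegerScrew
open Summit.RiemannHypothesis.RiemannHypothesis.Theorems.IntegerScrew.FozIndexBound
open Summit.RiemannHypothesis.RiemannHypothesis.Theorems.Splittings.BombieriFozNoDep
open Summit.RiemannHypothesis.RiemannHypothesis.Theorems.Splittings.ScrewBridgeRawG3
open Summit.RiemannHypothesis.RiemannHypothesis.Theorems.Splittings.ScrewBridgeFozConsequences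
open Summit.RiemannHypothesis.RiemannHypothesis.Theorems.Splittings.ScrewBridgeRungs

/-! ## §7a Orbit invariance of the real zero term -/

/-- `ρ ↦ 1 − ρ` leaves the zero term unchanged (`m(1−ρ) = m(ρ)`, `a ↦ −a` swaps the two Dirichlet
polynomial factors). [folklore] -/
theorem zeroTerm_one_sub (n : ℕ) (v : Fin n → ℝ) {ρ : ℂ} (hρ : ρ ∈ ZetaZeros.riemannZetaNontrivialZeros) :
    zeroTerm n v (1 - ρ) = zeroTerm n v ρ := by
  have h1 : (1 : ℂ) - ρ - 1 / 2 = -(ρ - 1 / 2) := by ring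
  unfold zeroTerm
  rw [riemannZetaZeroOrder_one_sub_holds (ZetaZeros.riemannZetaNontrivialZeros.re_pos hρ)
    (ZetaZeros.riemannZetaNontrivialZeros.re_lt_one hρ), h1, neg_neg]
  ring

/-- `ρ ↦ ρ̄` conjugates the zero term (`m(ρ̄) = m(ρ)`; the Dirichlet polynomials have real coefficients).
[folklore] -/
theorem zeroTerm_conj (n : ℕ) (v : Fin n → ℝ) (ρ : ℂ) :
    zeroTerm n v (conj ρ) = conj (zeroTerm n v ρ) := by
  have hP : ∀ a : ℂ, ∑ m ∈ Icc 1 (n + 1), ((yvec n v m : ℝ) : ℂ) * (m : ℂ) ^ (conj a) =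
      conj (∑ m ∈ Icc 1 (n + 1), ((yvec n v m : ℝ) : ℂ) * (m : ℂ) ^ a) := by
    intro a
    rw [map_sum]
    refine Finset.sum_congr rfl fun k _ => ?_
    have hk : (k : ℂ).arg ≠ Real.pi := by
      rw [Complex.natCast_arg]; exact Real.pi_pos.ne
    rw [map_mul, Complex.conj_ofReal, Complex.cpow_conj _ _ hk, map_natCast]
  have h1 : conj ρ - 1 / 2 = conj (ρ - 1 / 2) := by
    apply Complex.ext <;> simp
  unfold zeroTerm
  rw [riemannZetaZeroOrder_conj_holds ρ, h1, ← map_neg, hP, hP]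
  simp only [map_mul, map_div₀, map_neg, map_pow, map_intCast]

/-- Hence the REAL zero term is conjugation invariant. [folklore] -/
theorem re_zeroTerm_conj (n : ℕ) (v : Fin n → ℝ) (ρ : ℂ) :
    (zeroTerm n v (conj ρ)).re = (zeroTerm n v ρ).re := by
  rw [zeroTerm_conj, Complex.conj_re]

/-- **The real zero term is constant on Klein orbits**: it takes the same value at a non-trivial zero `s` and at
its quadrant representative `⟨max (Re s) (1 − Re s), |Im s|⟩ ∈ {s, s̄, 1 − s̄, 1 − s}`. [folklore] -/
theorem re_zeroTerm_rep (n : ℕ) (v : Fin n → ℝ) {s : ℂ} (hs : s ∈ ZetaZeros.riemannZetaNontrivialZeros) :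
    (zeroTerm n v (⟨max s.re (1 - s.re), |s.im|⟩ : ℂ)).re = (zeroTerm n v s).re := by
  rcases max_choice s.re (1 - s.re) with hm | hm <;> rcases abs_choice s.im with ha | ha
  · have : (⟨max s.re (1 - s.re), |s.im|⟩ : ℂ) = s := by
      apply Complex.ext <;> simp [hm, ha]
    rw [this]
  · have : (⟨max s.re (1 - s.re), |s.im|⟩ : ℂ) = conj s := by
      apply Complex.ext <;> simp [hm, ha]
    rw [this, re_zeroTerm_conj]
  · have : (⟨max s.re (1 - s.re), |s.im|⟩ : ℂ) = 1 - conj s := by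
      apply Complex.ext <;> simp [hm, ha]
    rw [this, zeroTerm_one_sub n v (ZetaZeros.riemannZetaNontrivialZeros.conj_mem hs), re_zeroTerm_conj]
  · have : (⟨max s.re (1 - s.re), |s.im|⟩ : ℂ) = 1 - s := by
      apply Complex.ext <;> simp [hm, ha]
    rw [this, zeroTerm_one_sub n v hs]

/-- The fibre of the representative map over `b` lies in the Klein orbit `{b, b̄, 1 − b̄, 1 − b}` (same lemma as
`ScrewBridgeG4.quadRep_fibre`; repeated here only to keep this scratch file self-contained). [folklore] -/
theorem rep_fibre {s b : ℂ} (h : (⟨max s.re (1 - s.re), |s.im|⟩ : ℂ) = b) :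
    s = b ∨ s = conj b ∨ s = 1 - conj b ∨ s = 1 - b := by
  have hre : max s.re (1 - s.re) = b.re := by rw [← h]
  have him : |s.im| = b.im := by rw [← h]
  rcases max_choice s.re (1 - s.re) with hm | hm <;> rcases abs_choice s.im with ha | ha
  · left; apply Complex.ext <;> linarith
  · right; left; apply Complex.ext <;> (try simp) <;> linarith
  · right; right; left; apply Complex.ext <;> (try simp) <;> linarith
  · right; right; right; apply Complex.ext <;> (try simp) <;> linarith

/-! ## §7b The sharp bound `n₋(S_n) ≤ 2·#representatives` -/

/-- **Engine**: if every non-trivial zero outside the finite set `O` is on the line and `R ⊂ ℂ` contains the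
representative of every member of `O`, then `n₋(S_n) ≤ 2·#R` for every `n` — the off-line part of the zero
expansion, regrouped by Klein orbits (`re_zeroTerm_rep`), is `Σ_{r ∈ R} c_r·(ℓ₁ℓ₃ − ℓ₂ℓ₄)(r)` with `c_r ∈ ℕ`, a sum of
`#R` real forms of signature `≤ (2,2)`; then `screwMatrix_finrank_negDef_le` + count ⟸ frame. [folklore] -/
theorem negIndex_le_two_mul_card_reps_of (O : Finset ZetaZeros.riemannZetaNontrivialZeros)
    (hO : ∀ ρ : ZetaZeros.riemannZetaNontrivialZeros, ρ ∉ O → (ρ : ℂ).re = 1 / 2) (R : Finset ℂ)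
    (hR : ∀ ρ ∈ O, (⟨max (ρ : ℂ).re (1 - (ρ : ℂ).re), |(ρ : ℂ).im|⟩ : ℂ) ∈ R) (n : ℕ) :
    (Finset.univ.filter fun i => (screwMatrix_isHermitian n).eigenvalues i < 0).card ≤ 2 * R.card := by
  classical
  -- multiplicity of a representative inside `O`
  let c : ℂ → ℝ := fun r =>
    ((O.filter fun ρ : ZetaZeros.riemannZetaNontrivialZeros =>
      (⟨max (ρ : ℂ).re (1 - (ρ : ℂ).re), |(ρ : ℂ).im|⟩ : ℂ) = r).card : ℝ)
  let e : Fin R.card ≃ {r // r ∈ R} := R.equivFin.symm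
  let L₁ : Fin R.card → ((Fin n → ℝ) →ₗ[ℝ] ℝ) := fun j => c (e j : ℂ) • ell₁ n (e j : ℂ)
  let L₂ : Fin R.card → ((Fin n → ℝ) →ₗ[ℝ] ℝ) := fun j => c (e j : ℂ) • ell₂ n (e j : ℂ)
  let L₃ : Fin R.card → ((Fin n → ℝ) →ₗ[ℝ] ℝ) := fun j => ell₃ n (e j : ℂ)
  let L₄ : Fin R.card → ((Fin n → ℝ) →ₗ[ℝ] ℝ) := fun j => ell₄ n (e j : ℂ)
  -- the off-line part of the zero expansion regrouped by orbits
  have hgroup : ∀ x : Fin n → ℝ,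
      ∑ ρ ∈ O, (zeroTerm n x (ρ : ℂ)).re = ∑ r ∈ R, c r * (zeroTerm n x r).re := by
    intro x
    have h1 : ∑ ρ ∈ O, (zeroTerm n x (ρ : ℂ)).re =
        ∑ ρ ∈ O, (zeroTerm n x (⟨max (ρ : ℂ).re (1 - (ρ : ℂ).re), |(ρ : ℂ).im|⟩ : ℂ)).re :=
      Finset.sum_congr rfl fun ρ _ => (re_zeroTerm_rep n x ρ.2).symm
    rw [h1, ← Finset.sum_fiberwise_of_maps_to' hR (fun r : ℂ => (zeroTerm n x r).re)]
    refine Finset.sum_congr rfl fun r _ => ?_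
    rw [Finset.sum_const, nsmul_eq_mul]
  have hoff : ∀ x : Fin n → ℝ, ∑ j, (L₁ j x * L₃ j x - L₂ j x * L₄ j x) =
      ∑ ρ ∈ O, (zeroTerm n x (ρ : ℂ)).re := by
    intro x
    rw [hgroup x]
    have h3 : ∀ j, L₁ j x * L₃ j x - L₂ j x * L₄ j x = c (e j : ℂ) * (zeroTerm n x (e j : ℂ)).re := by
      intro j
      simp only [L₁, L₂, L₃, L₄, LinearMap.smul_apply, smul_eq_mul, re_zeroTerm_eq_ell]
      ring
    simp only [h3]
    rw [Equiv.sum_comp e (fun r : {r // r ∈ R} => c (r : ℂ) * (zeroTerm n x (r : ℂ)).re)]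
    exact Finset.sum_coe_sort R (fun r : ℂ => c r * (zeroTerm n x r).re)
  apply card_eigenvalues_neg_le_of_subspace_bound (screwMatrix_isHermitian n)
  intro N hN
  refine screwMatrix_finrank_negDef_le
    (P := fun x => x ⬝ᵥ (screwMatrix n *ᵥ x) - ∑ j, (L₁ j x * L₃ j x - L₂ j x * L₄ j x))
    ?_ L₁ L₂ L₃ L₄ (fun x => by ring) N hN
  intro x
  have := sum_re_zeroTerm_le_form O hO n x
  rw [star_trivial] at this
  rw [hoff]
  linarith

/-- If a finite `R ⊂ ℂ` contains the representative of EVERY off-line non-trivial zero, the off-line zeros are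
finitely many (each fibre of the representative map has at most four points). [folklore] -/
theorem offLine_finite_of_reps (R : Finset ℂ)
    (hR : ∀ ρ : ZetaZeros.riemannZetaNontrivialZeros, (ρ : ℂ).re ≠ 1 / 2 →
      (⟨max (ρ : ℂ).re (1 - (ρ : ℂ).re), |(ρ : ℂ).im|⟩ : ℂ) ∈ R) :
    ({ρ | (ρ : ℂ).re ≠ 1 / 2} : Set ZetaZeros.riemannZetaNontrivialZeros).Finite := by
  classical
  have hT : (↑(R.biUnion fun r => ({r, conj r, 1 - conj r, 1 - r} : Finset ℂ)) : Set ℂ).Finite :=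
    Finset.finite_toSet _
  refine (hT.preimage Subtype.val_injective.injOn).subset ?_
  intro ρ hρ
  simp only [Set.mem_preimage, Finset.coe_biUnion, Finset.mem_coe, Set.mem_iUnion, Finset.mem_insert,
    Finset.mem_singleton]
  exact ⟨_, hR ρ hρ, rep_fibre rfl⟩

/-- **The sharp orbit bound (RH-free)**: if a finite set `R ⊂ ℂ` contains the quadrant representative
`⟨max (Re ρ) (1 − Re ρ), |Im ρ|⟩` of every off-line non-trivial zero `ρ` — e.g. `R` = one point per Klein orbit
`{ρ, ρ̄, 1−ρ̄, 1−ρ}` — then EVERY screw Gram matrix has at most `2·#R` negative eigenvalues.  One quadruple (simple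
or not) can therefore never produce more than two negative eigenvalues; the landed `fozIndexBound` gives only
`2·#{off-line zeros}` (= 8 per quadruple). [folklore] -/
theorem negIndex_le_two_mul_card_reps (R : Finset ℂ)
    (hR : ∀ ρ : ZetaZeros.riemannZetaNontrivialZeros, (ρ : ℂ).re ≠ 1 / 2 →
      (⟨max (ρ : ℂ).re (1 - (ρ : ℂ).re), |(ρ : ℂ).im|⟩ : ℂ) ∈ R) (n : ℕ) :
    (Finset.univ.filter fun i => (screwMatrix_isHermitian n).eigenvalues i < 0).card ≤ 2 * R.card := by
  classical
  set O : Finset ZetaZeros.riemannZetaNontrivialZeros := (offLine_finite_of_reps R hR).toFinset with hOdef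
  refine negIndex_le_two_mul_card_reps_of O (fun ρ hρ => ?_) R (fun ρ hρ => hR ρ ?_) n
  · by_contra hne
    exact hρ (by rw [hOdef, Set.Finite.mem_toFinset]; exact hne)
  · rw [hOdef, Set.Finite.mem_toFinset] at hρ
    exact hρ

/-- FOZ form: finitely many off-line zeros ⟹ `∃` a finite set of representatives `R` with `n₋(S_n) ≤ 2·#R` for
all `n` (the sharp version of the landed `fozIndexBound`; `#R` = the number of off-line Klein orbits when `R` is
chosen minimal). [folklore] -/
theorem foz_negIndex_le_two_mul_card_reps (hfoz : CofiniteCriticalLine) :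
    ∃ R : Finset ℂ,
      (∀ ρ : ZetaZeros.riemannZetaNontrivialZeros, (ρ : ℂ).re ≠ 1 / 2 →
        (⟨max (ρ : ℂ).re (1 - (ρ : ℂ).re), |(ρ : ℂ).im|⟩ : ℂ) ∈ R) ∧
      ∀ n : ℕ, (Finset.univ.filter fun i => (screwMatrix_isHermitian n).eigenvalues i < 0).card ≤ 2 * R.card := by
  classical
  have hfin : ({ρ | (ρ : ℂ).re ≠ 1 / 2} : Set ZetaZeros.riemannZetaNontrivialZeros).Finite := by
    refine (Set.Finite.preimage Subtype.val_injective.injOn hfoz).subset ?_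
    intro ρ hρ
    obtain ⟨hz, h0, h1⟩ := ZetaZeros.riemannZetaNontrivialZeros.mem_iff'.1 ρ.2
    exact ⟨hz, h0, h1, hρ⟩
  refine ⟨hfin.toFinset.image fun ρ : ZetaZeros.riemannZetaNontrivialZeros =>
    (⟨max (ρ : ℂ).re (1 - (ρ : ℂ).re), |(ρ : ℂ).im|⟩ : ℂ), ?_, ?_⟩
  · intro ρ hρ
    exact Finset.mem_image_of_mem _ (by rw [Set.Finite.mem_toFinset]; exact hρ)
  · intro n
    exact negIndex_le_two_mul_card_reps _ (fun ρ hρ =>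
      Finset.mem_image_of_mem _ (by rw [Set.Finite.mem_toFinset]; exact hρ)) n

/-! ## §7c–§7d The typed Lemma U is unattainable off RH; Lemma U with the factor 2 -/

/-- Three distinct members `ρ, ρ̄, 1 − ρ̄` of the Klein orbit of an off-line zero share its representative: every
fibre of the representative map inside a set containing all off-line zeros has at least three points (in fact
four). [folklore] -/
theorem three_le_card_fibre (O : Finset ZetaZeros.riemannZetaNontrivialZeros)
    (hO : ∀ ρ : ZetaZeros.riemannZetaNontrivialZeros, (ρ : ℂ).re ≠ 1 / 2 → ρ ∈ O)
    {ρ : ZetaZeros.riemannZetaNontrivialZeros} (hρ : (ρ : ℂ).re ≠ 1 / 2) :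
    3 ≤ (O.filter fun σ : ZetaZeros.riemannZetaNontrivialZeros =>
      (⟨max (σ : ℂ).re (1 - (σ : ℂ).re), |(σ : ℂ).im|⟩ : ℂ) =
        (⟨max (ρ : ℂ).re (1 - (ρ : ℂ).re), |(ρ : ℂ).im|⟩ : ℂ)).card := by
  classical
  have him : (ρ : ℂ).im ≠ 0 := ZetaZeros.riemannZetaNontrivialZeros.im_ne_zero ρ.2
  set ρ₁ : ZetaZeros.riemannZetaNontrivialZeros :=
    ⟨conj (ρ : ℂ), ZetaZeros.riemannZetaNontrivialZeros.conj_mem ρ.2⟩ with hρ₁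
  set ρ₂ : ZetaZeros.riemannZetaNontrivialZeros :=
    ⟨1 - conj (ρ : ℂ), ZetaZeros.riemannZetaNontrivialZeros.one_sub_conj_mem ρ.2⟩ with hρ₂
  have hv₁ : (ρ₁ : ℂ) = conj (ρ : ℂ) := by rw [hρ₁]
  have hv₂ : (ρ₂ : ℂ) = 1 - conj (ρ : ℂ) := by rw [hρ₂]
  have h01 : ρ ≠ ρ₁ := by
    intro h
    have := congrArg (fun σ : ZetaZeros.riemannZetaNontrivialZeros => (σ : ℂ).im) h
    simp only [hv₁, Complex.conj_im] at this
    exact him (by linarith)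
  have h02 : ρ ≠ ρ₂ := by
    intro h
    have := congrArg (fun σ : ZetaZeros.riemannZetaNontrivialZeros => (σ : ℂ).re) h
    simp only [hv₂, Complex.sub_re, Complex.one_re, Complex.conj_re] at this
    exact hρ (by linarith)
  have h12 : ρ₁ ≠ ρ₂ := by
    intro h
    have := congrArg (fun σ : ZetaZeros.riemannZetaNontrivialZeros => (σ : ℂ).re) h
    simp only [hv₁, hv₂, Complex.sub_re, Complex.one_re, Complex.conj_re] at this
    exact hρ (by linarith)
  have hcard : ({ρ, ρ₁, ρ₂} : Finset ZetaZeros.riemannZetaNontrivialZeros).card = 3 :=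
    Finset.card_eq_three.mpr ⟨ρ, ρ₁, ρ₂, h01, h02, h12, rfl⟩
  rw [← hcard]
  apply Finset.card_le_card
  intro σ hσ
  simp only [Finset.mem_insert, Finset.mem_singleton] at hσ
  rw [Finset.mem_filter]
  rcases hσ with rfl | rfl | rfl
  · exact ⟨hO _ hρ, rfl⟩
  · refine ⟨hO _ ?_, ?_⟩
    · rw [hv₁, Complex.conj_re]; exact hρ
    · apply Complex.ext
      · simp only [hv₁, Complex.conj_re]
      · simp only [hv₁, Complex.conj_im, abs_neg]
  · refine ⟨hO _ ?_, ?_⟩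
    · rw [hv₂, Complex.sub_re, Complex.one_re, Complex.conj_re]
      intro h; exact hρ (by linarith)
    · apply Complex.ext
      · simp only [hv₂, Complex.sub_re, Complex.one_re, Complex.conj_re, sub_sub_cancel, max_comm]
      · simp only [hv₂, Complex.sub_im, Complex.one_im, Complex.conj_im, sub_neg_eq_add, zero_add]

/-- **The typed Lemma U is unattainable off RH** (rh-splitx-eng-3's finding 00:38:42Z, kernel form): the
hypothesis `hU` of the landed `ScrewBridgeRungs.indexTransfer_of_indexLowerBound` («every finite set `F` of
OFF-LINE zeros is eventually matched by `F.card` negative eigenvalues»), together with FOZ, already gives RH —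
under FOZ ∧ ¬RH the off-line set `O` has `#O ≥ 3·#R > 2·#R ≥ n₋(S_n)` for its set of representatives `R`.  So
`hU` is of strength `≥ (FOZ → RH)`: the landed transfer theorem is true but can only be applied vacuously; the
repaired forms are `indexTransfer_of_indexLowerBound_two` below (factor 2) and
`ScrewBridgeG4.indexTransfer_of_indexLowerBoundQuad` (representatives). [folklore] -/
theorem rh_of_foz_of_indexLowerBound
    (hU : ∀ F : Finset ZetaZeros.riemannZetaNontrivialZeros, (∀ ρ ∈ F, (ρ : ℂ).re ≠ 1 / 2) →
      ∃ N : ℕ, ∀ n : ℕ, N ≤ n →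
        F.card ≤ (Finset.univ.filter fun i => (screwMatrix_isHermitian n).eigenvalues i < 0).card)
    (hfoz : CofiniteCriticalLine) : _root_.RiemannHypothesis := by
  classical
  by_contra hRH
  obtain ⟨ρ₀, hρ₀, hoff₀⟩ := exists_offLine_of_not_rh hRH
  have hfin : ({ρ | (ρ : ℂ).re ≠ 1 / 2} : Set ZetaZeros.riemannZetaNontrivialZeros).Finite := by
    refine (Set.Finite.preimage Subtype.val_injective.injOn hfoz).subset ?_
    intro ρ hρ
    obtain ⟨hz, h0, h1⟩ := ZetaZeros.riemannZetaNontrivialZeros.mem_iff'.1 ρ.2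
    exact ⟨hz, h0, h1, hρ⟩
  set O : Finset ZetaZeros.riemannZetaNontrivialZeros := hfin.toFinset with hOdef
  have hmemO : ∀ ρ : ZetaZeros.riemannZetaNontrivialZeros, ρ ∈ O ↔ (ρ : ℂ).re ≠ 1 / 2 := by
    intro ρ; rw [hOdef, Set.Finite.mem_toFinset]; rfl
  set R : Finset ℂ := O.image fun ρ : ZetaZeros.riemannZetaNontrivialZeros =>
    (⟨max (ρ : ℂ).re (1 - (ρ : ℂ).re), |(ρ : ℂ).im|⟩ : ℂ) with hRdef
  have hle : ∀ n : ℕ,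
      (Finset.univ.filter fun i => (screwMatrix_isHermitian n).eigenvalues i < 0).card ≤ 2 * R.card :=
    fun n => negIndex_le_two_mul_card_reps_of O
      (fun ρ hρ => by by_contra h; exact hρ ((hmemO ρ).2 h)) R
      (fun ρ hρ => by rw [hRdef]; exact Finset.mem_image_of_mem _ hρ) n
  have h3 : 3 * R.card ≤ O.card := by
    rw [hRdef]
    refine Finset.mul_card_image_le_card O 3 fun r hr => ?_
    obtain ⟨ρ, hρO, rfl⟩ := Finset.mem_image.mp hr
    exact three_le_card_fibre O (fun σ hσ => (hmemO σ).2 hσ) ((hmemO ρ).1 hρO)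
  have hR0 : 0 < R.card := by
    rw [Finset.card_pos, hRdef]
    exact ⟨_, Finset.mem_image_of_mem _ ((hmemO ⟨ρ₀, hρ₀⟩).2 hoff₀)⟩
  obtain ⟨N, hN⟩ := hU O fun ρ hρ => (hmemO ρ).1 hρ
  have h1 := hN N le_rfl
  have h2 := hle N
  omega

/-- Conversely under RH the typed Lemma U holds vacuously (there is no off-line zero). [folklore] -/
theorem indexLowerBound_of_rh (h : _root_.RiemannHypothesis)
    (F : Finset ZetaZeros.riemannZetaNontrivialZeros) (hF : ∀ ρ ∈ F, (ρ : ℂ).re ≠ 1 / 2) :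
    ∃ N : ℕ, ∀ n : ℕ, N ≤ n →
      F.card ≤ (Finset.univ.filter fun i => (screwMatrix_isHermitian n).eigenvalues i < 0).card := by
  have hF0 : F = ∅ :=
    Finset.eq_empty_of_forall_notMem fun ρ hρ => hF ρ hρ (re_eq_half_of_rh h ρ.2)
  subst hF0
  exact ⟨0, fun n _ => by simp⟩

/-- **Book-keeping of record**: «typed Lemma U ∧ FOZ» is EXACTLY RH — the pair is the K-costume
`(FOZ → RH) ∧ FOZ` in screw clothing. [folklore] -/
theorem indexLowerBound_and_foz_iff_rh :
    ((∀ F : Finset ZetaZeros.riemannZetaNontrivialZeros, (∀ ρ ∈ F, (ρ : ℂ).re ≠ 1 / 2) →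
        ∃ N : ℕ, ∀ n : ℕ, N ≤ n →
          F.card ≤ (Finset.univ.filter fun i => (screwMatrix_isHermitian n).eigenvalues i < 0).card) ∧
      CofiniteCriticalLine) ↔ _root_.RiemannHypothesis :=
  ⟨fun h => rh_of_foz_of_indexLowerBound h.1 h.2,
    fun h => ⟨indexLowerBound_of_rh h, cofiniteCriticalLine_of_rh h⟩⟩

/-- **Lemma U with the factor 2 ⟹ R3** (the referee's T-R3′ of record, 00:46:38Z): if every finite set `F` of
off-line zeros is eventually matched by `F.card ≤ 2·n₋(S_n)` (two negative squares per quadruple, four members per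
quadruple: `n₋ → 2q`), then a bounded negative index forces FOZ.  Same proof as the landed
`indexTransfer_of_indexLowerBound`, with `2K + 1` zeros. [folklore] -/
theorem indexTransfer_of_indexLowerBound_two
    (hU : ∀ F : Finset ZetaZeros.riemannZetaNontrivialZeros, (∀ ρ ∈ F, (ρ : ℂ).re ≠ 1 / 2) →
      ∃ N : ℕ, ∀ n : ℕ, N ≤ n →
        F.card ≤ 2 * (Finset.univ.filter fun i => (screwMatrix_isHermitian n).eigenvalues i < 0).card) :
    (∃ K : ℕ, ∀ n : ℕ, (Finset.univ.filter fun i => (screwMatrix_isHermitian n).eigenvalues i < 0).card ≤ K) →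
      CofiniteCriticalLine := by
  rintro ⟨K, hK⟩
  by_contra hS
  have hpre : (Subtype.val ⁻¹'
      {s : ℂ | riemannZeta s = 0 ∧ 0 < s.re ∧ s.re < 1 ∧ s.re ≠ 1 / 2} :
        Set ZetaZeros.riemannZetaNontrivialZeros).Infinite := by
    intro hfin
    apply hS
    have himg := hfin.image (Subtype.val : ZetaZeros.riemannZetaNontrivialZeros → ℂ)
    refine himg.subset ?_
    intro s hs
    exact ⟨⟨s, ZetaZeros.riemannZetaNontrivialZeros.mem_iff'.2 ⟨hs.1, hs.2.1, hs.2.2.1⟩⟩, hs, rfl⟩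
  obtain ⟨F, hFsub, hFcard⟩ := hpre.exists_subset_card_eq (2 * K + 1)
  have hoff : ∀ ρ ∈ F, (ρ : ℂ).re ≠ 1 / 2 := by
    intro ρ hρ
    have hρS : riemannZeta (ρ : ℂ) = 0 ∧ 0 < (ρ : ℂ).re ∧ (ρ : ℂ).re < 1 ∧ (ρ : ℂ).re ≠ 1 / 2 :=
      hFsub (Finset.mem_coe.mpr hρ)
    exact hρS.2.2.2
  obtain ⟨N, hN⟩ := hU F hoff
  have h1 := hN N le_rfl
  have h2 := hK N
  omega

/-- With Lemma U (factor 2), `ETAIL ⟺ FOZ` holds modulo R2 alone (`ScrewBridgeFozConsequences.etail_iff_foz_of`).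
[folklore] -/
theorem etail_iff_foz_of_indexLowerBound_two
    (hU : ∀ F : Finset ZetaZeros.riemannZetaNontrivialZeros, (∀ ρ ∈ F, (ρ : ℂ).re ≠ 1 / 2) →
      ∃ N : ℕ, ∀ n : ℕ, N ≤ n →
        F.card ≤ 2 * (Finset.univ.filter fun i => (screwMatrix_isHermitian n).eigenvalues i < 0).card)
    (h2 : CofiniteCriticalLine → (∃ N : ℕ, ∀ n : ℕ, N ≤ n → screwDet n ≠ 0)) :
    (∃ M₀ : ℕ, ∀ M : ℕ, M₀ ≤ M → 0 < screwPivot M) ↔ CofiniteCriticalLine :=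
  etail_iff_foz_of (indexTransfer_of_indexLowerBound_two hU) h2

end Summit.RiemannHypothesis.RiemannHypothesis.Theorems.Splittings.ScrewOrbitIndexBound

end
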